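import Mathlib

/-!
# Linear slaving along the linear cone and the inner regular-singular form (K32)

Solo seat `solo-NavierStokesRegularity-informed`, session 14; companion of `paper/axisymmetric-rigidity.md` §5h,
THEOREM 8.27(i) (`lim σ³ κ(σ) = 27/(32π)`), STEPS 1–4 of its proof. Along the closed linear system (LC_σ) of Prop. 8.26,
  `P' = -Ω Q`, `Q' = Ω P - h P + (3/(2 sin²φ)) 𝓋`, `𝓋' = 2 cot φ 𝓋 - (3/(2σ sin φ)) P`, `Ω = 4σ/(3 cos φ)`,
this file certifies (with `s = sin φ`, `co = cos φ` as real variables, derivatives as values constrained by the equations):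
* `linSlave_alpha_hasDerivAt`, `linSlave_beta_hasDerivAt`: the derivatives of the slow-graph coefficients
  `α₁ = -9 cos φ/(8σ sin²φ)` and `β₂ = -27 cos φ/(32 σ² sin φ)`;
* `linSlave_alpha_cancel`, `linSlave_beta_cancel`: `Ω α₁ + 3/(2s²) = 0` and `Ω β₂ + α₁' + 2 cot φ·α₁ = 0` — the two cancellations
  that define the first-order slow manifold;
* `linSlave_ptilde`, `linSlave_qtilde`, `linSlave_energy`, `linSlave_v_over_s2`: the equations of the fast remainders
  `p̃ = P - α₁𝓋`, `q̃ = Q - β₂𝓋`, the energy identity `(p̃² + q̃²)' = 2a p̃² + 2(b - h) p̃ q̃ + 2𝓋(r_P p̃ + r_Q q̃)` (the fast frequency `Ω`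
  drops out) and `(𝓋/sin²φ)' = -3P/(2σ sin³φ)` (Lemma B′);
* `linSlave_constants`: the numerical inequalities used in the bootstrap of Lemma B′;
* `innerLC_of_core_ν/_P/_Q`: the map `f ↦ (P̂, Q̂, ν) = (2f/ξ - (4ξ/3) f_τ, 2τ f_ττ - 2 f_τ + (3/2) f/τ, f/ξ)`, `τ = ξ²`, sends solutions of the
  CORE equation `τ² f''' + (4/9) τ f' - (2/3) f = 0` (K31) to solutions of the inner limit system (LC⁰)
  `P̂' = -(4/3) Q̂`, `Q̂' = (4/3 - 9/(4ξ²)) P̂ + (3/(2ξ²)) ν`, `ν' = (2/ξ) ν - (3/(2ξ)) P̂` (STEP 2(a));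
* `innerLC_residue_charpoly`, `innerLC_Zhat_det`: the residue matrix of (LC^ε) in `z = (ξν, ξP̂, ξ²Q̂)` has characteristic polynomial
  `-λ(λ-2)(λ-4)`, and the matrix of leading coefficients of the Frobenius basis is invertible (`det = -16/3`) (STEPS 2(b), 3);
* `innerLC_Qhat_exponent`, `innerLC_handover_coeffs`: the cancellation `2μ² - 4μ + 3/2 = 2(μ - 3/2)(μ - 1/2)` (no `τ^{1/2}`, `τ^{-1/2}` terms in `Q̂_D`)
  and the hand-over coefficients `(4/3)a₁ = -27/16`, `(8/3)a₂ = -729/512`, `N(D)·ξ₀² → 729/256` (STEP 4(b)).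
No new definitions; axioms: standard.
-/

namespace Summit.NavierStokesRegularity.NavierStokesRegularity.Theorems

/-! ### The slow-graph coefficients and their derivatives -/

/-- `d/dφ [-9 cos φ/(8σ sin²φ)] = 9 (sin²φ + 2 cos²φ)/(8 σ sin³φ)`. -/
theorem linSlave_alpha_hasDerivAt (σ : ℝ) {φ : ℝ} (hs : Real.sin φ ≠ 0) :
    HasDerivAt (fun φ => -9 * Real.cos φ / (8 * σ * Real.sin φ ^ 2))
      (9 * (Real.sin φ ^ 2 + 2 * Real.cos φ ^ 2) / (8 * σ * Real.sin φ ^ 3)) φ := by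
  rcases eq_or_ne σ 0 with hσ | hσ
  · subst hσ
    simp only [mul_zero, zero_mul, div_zero]
    exact hasDerivAt_const φ 0
  have h1 : HasDerivAt (fun φ => Real.sin φ ^ 2) (2 * Real.sin φ * Real.cos φ) φ := by
    have := (Real.hasDerivAt_sin φ).mul (Real.hasDerivAt_sin φ)
    refine (this.congr_deriv (by ring)).congr_of_eventuallyEq ?_
    exact Filter.Eventually.of_forall fun x => by simp [pow_two]
  have h2 : HasDerivAt (fun φ => 8 * σ * Real.sin φ ^ 2) (8 * σ * (2 * Real.sin φ * Real.cos φ)) φ := h1.const_mul _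
  have h3 : HasDerivAt (fun φ => -9 * Real.cos φ) (-9 * -Real.sin φ) φ := (Real.hasDerivAt_cos φ).const_mul _
  have hne : 8 * σ * Real.sin φ ^ 2 ≠ 0 := by positivity
  have h := h3.div h2 hne
  refine h.congr_deriv ?_
  field_simp
  ring

/-- `d/dφ [-27 cos φ/(32 σ² sin φ)] = 27 (sin²φ + cos²φ)/(32 σ² sin²φ)`. -/
theorem linSlave_beta_hasDerivAt (σ : ℝ) {φ : ℝ} (hs : Real.sin φ ≠ 0) :
    HasDerivAt (fun φ => -27 * Real.cos φ / (32 * σ ^ 2 * Real.sin φ))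
      (27 * (Real.sin φ ^ 2 + Real.cos φ ^ 2) / (32 * σ ^ 2 * Real.sin φ ^ 2)) φ := by
  rcases eq_or_ne σ 0 with hσ | hσ
  · subst hσ
    simp only [ne_eq, OfNat.ofNat_ne_zero, not_false_eq_true, zero_pow, mul_zero, zero_mul, div_zero]
    exact hasDerivAt_const φ 0
  have h2 : HasDerivAt (fun φ => 32 * σ ^ 2 * Real.sin φ) (32 * σ ^ 2 * Real.cos φ) φ :=
    (Real.hasDerivAt_sin φ).const_mul _
  have h3 : HasDerivAt (fun φ => -27 * Real.cos φ) (-27 * -Real.sin φ) φ := (Real.hasDerivAt_cos φ).const_mul _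
  have hne : 32 * σ ^ 2 * Real.sin φ ≠ 0 := by positivity
  have h := h3.div h2 hne
  refine h.congr_deriv ?_
  field_simp
  ring

/-! ### The two cancellations defining the first-order slow manifold -/

/-- `Ω α₁ + 3/(2 s²) = 0`. -/
theorem linSlave_alpha_cancel (σ s co : ℝ) (hσ : σ ≠ 0) (hs : s ≠ 0) (hco : co ≠ 0) :
    4 * σ / (3 * co) * (-9 * co / (8 * σ * s ^ 2)) + 3 / (2 * s ^ 2) = 0 := by
  field_simp
  ring

/-- `Ω β₂ + α₁' + 2 cot φ · α₁ = 0` (with `α₁' = 9 (s² + 2co²)/(8σ s³)`; no use of `s² + co² = 1`). -/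
theorem linSlave_beta_cancel (σ s co : ℝ) (hσ : σ ≠ 0) (hs : s ≠ 0) (hco : co ≠ 0) :
    4 * σ / (3 * co) * (-27 * co / (32 * σ ^ 2 * s))
      + 9 * (s ^ 2 + 2 * co ^ 2) / (8 * σ * s ^ 3) + 2 * (co / s) * (-9 * co / (8 * σ * s ^ 2)) = 0 := by
  field_simp
  ring

/-! ### Lemma B′: remainder equations, energy identity, slow variable -/

/-- Equation of `p̃ = P - α₁ 𝓋`: `p̃' = -Ω q̃ + a p̃ + r_P 𝓋` with `a = 3α₁/(2σ s) = -27co/(16σ²s³)`, `r_P = 3α₁²/(2σ s) = 243 co²/(128 σ³ s⁵)`. -/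
theorem linSlave_ptilde (σ s co P Q v dP dv : ℝ) (hσ : σ ≠ 0) (hs : s ≠ 0) (hco : co ≠ 0)
    (hP : dP = -(4 * σ / (3 * co)) * Q)
    (hv : dv = 2 * (co / s) * v - 3 / (2 * σ * s) * P) :
    dP - 9 * (s ^ 2 + 2 * co ^ 2) / (8 * σ * s ^ 3) * v - (-9 * co / (8 * σ * s ^ 2)) * dv
      = -(4 * σ / (3 * co)) * (Q - (-27 * co / (32 * σ ^ 2 * s)) * v)
        + (-27 * co / (16 * σ ^ 2 * s ^ 3)) * (P - (-9 * co / (8 * σ * s ^ 2)) * v)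
        + (243 * co ^ 2 / (128 * σ ^ 3 * s ^ 5)) * v := by
  subst hP hv
  field_simp
  ring

/-- Equation of `q̃ = Q - β₂ 𝓋`: `q̃' = (Ω - h + b) p̃ + r_Q 𝓋` with `b = 3β₂/(2σ s) = -81co/(64σ³s²)` and
`r_Q = 81co²/(32σ²s⁴) - 27(s² + co²)/(32σ²s²) + 729co²/(512σ⁴s⁴)` (`β₂' = 27(s²+co²)/(32σ²s²)`; no use of `s² + co² = 1`). -/
theorem linSlave_qtilde (σ s co P v dQ dv : ℝ) (hσ : σ ≠ 0) (hs : s ≠ 0) (hco : co ≠ 0)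
    (hQ : dQ = 4 * σ / (3 * co) * P - co * (9 / 4 - 3 / 2 * s ^ 2) / (σ * s ^ 2) * P + 3 / (2 * s ^ 2) * v)
    (hv : dv = 2 * (co / s) * v - 3 / (2 * σ * s) * P) :
    dQ - 27 * (s ^ 2 + co ^ 2) / (32 * σ ^ 2 * s ^ 2) * v - (-27 * co / (32 * σ ^ 2 * s)) * dv
      = (4 * σ / (3 * co) - co * (9 / 4 - 3 / 2 * s ^ 2) / (σ * s ^ 2) + (-81 * co / (64 * σ ^ 3 * s ^ 2)))
          * (P - (-9 * co / (8 * σ * s ^ 2)) * v)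
        + (81 * co ^ 2 / (32 * σ ^ 2 * s ^ 4) - 27 * (s ^ 2 + co ^ 2) / (32 * σ ^ 2 * s ^ 2)
            + 729 * co ^ 2 / (512 * σ ^ 4 * s ^ 4)) * v := by
  subst hQ hv
  field_simp
  ring

/-- The energy identity: `(p̃² + q̃²)' = 2a p̃² + 2(b - h) p̃ q̃ + 2𝓋 (r_P p̃ + r_Q q̃)` — the fast frequency `Ω` drops out. -/
theorem linSlave_energy (Ω h a b rP rQ p q v : ℝ) :
    2 * p * (-Ω * q + a * p + rP * v) + 2 * q * ((Ω - h + b) * p + rQ * v)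
      = 2 * a * p ^ 2 + 2 * (b - h) * p * q + 2 * v * (rP * p + rQ * q) := by
  ring

/-- The slow variable: `(𝓋/s²)' = -3P/(2σ s³)` (with `s' = co`). -/
theorem linSlave_v_over_s2 (σ s co P v dv : ℝ) (hσ : σ ≠ 0) (hs : s ≠ 0)
    (hv : dv = 2 * (co / s) * v - 3 / (2 * σ * s) * P) :
    dv / s ^ 2 - 2 * v * co / s ^ 3 = -3 * P / (2 * σ * s ^ 3) := by
  subst hv
  field_simp
  ring

/-- Numerical constants of the bootstrap in Lemma B′ (`σ ≥ 8`, `ŝ ≥ 4`):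
`K ≤ 0.34`; `σŝ·B ≤ 8.3` (with `π < 3.1416`); `1.405 · 8.3 ≤ 12`; `ρ ≤ 0.17`; the bootstrap closes below `2`. -/
theorem linSlave_constants :
    (27 / (32 * 4 ^ 2) + 9 / (8 * 4) + 81 / (128 * 8 ^ 2 * 4) : ℝ) ≤ 0.34
    ∧ (243 / (128 * 4) + 81 / 16 + 27 * Real.pi / 32 + 729 / (256 * 8 ^ 2) : ℝ) ≤ 8.3
    ∧ (1.405 * 8.3 : ℝ) ≤ 12
    ∧ (18 / (8 ^ 2 * 4) + 6 / 4 ^ 3 : ℝ) ≤ 0.17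
    ∧ ((3 / 2 + 0.17) / (1 - 27 / (32 * 4 ^ 2)) : ℝ) < 2 := by
  refine ⟨by norm_num, ?_, by norm_num, by norm_num, by norm_num⟩
  have := Real.pi_lt_d6
  nlinarith

/-! ### STEP 2(a): the inner limit system is the CORE equation -/

/-- `ν = f/ξ`: with `ν' = 2ξ·(f_τ/ξ) - f/ξ²` (chain rule, `τ = ξ²`), `ν' = (2/ξ)ν - (3/(2ξ)) P̂`. -/
theorem innerLC_of_core_ν (ξ f f1 : ℝ) (hξ : ξ ≠ 0) :
    2 * ξ * (f1 / ξ) - f / ξ ^ 2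
      = 2 / ξ * (f / ξ) - 3 / (2 * ξ) * (2 * f / ξ - 4 * ξ / 3 * f1) := by
  field_simp
  ring

/-- `P̂ = 2f/ξ - (4ξ/3) f_τ`: with `P̂' = 4 f_τ - 2f/ξ² - (4/3) f_τ - (8τ/3) f_ττ` (chain rule), `P̂' = -(4/3) Q̂`. -/
theorem innerLC_of_core_P (ξ f f1 f2 : ℝ) (hξ : ξ ≠ 0) :
    4 * f1 - 2 * f / ξ ^ 2 - 4 / 3 * f1 - 8 * ξ ^ 2 / 3 * f2
      = -(4 / 3) * (2 * ξ ^ 2 * f2 - 2 * f1 + 3 / 2 * f / ξ ^ 2) := by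
  field_simp
  ring

/-- `Q̂ = 2τ f_ττ - 2 f_τ + (3/2) f/τ`: with `Q̂' = 2ξ·(2τ f''' + (3/2) f_τ/τ - (3/2) f/τ²)` (chain rule) and the CORE equation
`τ² f''' = -(4/9) τ f_τ + (2/3) f`, `Q̂' = (4/3 - 9/(4ξ²)) P̂ + (3/(2ξ²)) ν`. -/
theorem innerLC_of_core_Q (ξ f f1 f3 : ℝ) (hξ : ξ ≠ 0)
    (hcore : (ξ ^ 2) ^ 2 * f3 + 4 / 9 * ξ ^ 2 * f1 - 2 / 3 * f = 0) :
    2 * ξ * (2 * ξ ^ 2 * f3 + 3 / 2 * f1 / ξ ^ 2 - 3 / 2 * f / (ξ ^ 2) ^ 2)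
      = (4 / 3 - 9 / (4 * ξ ^ 2)) * (2 * f / ξ - 4 * ξ / 3 * f1) + 3 / (2 * ξ ^ 2) * (f / ξ) := by
  have h3 : f3 = (-(4 / 9) * ξ ^ 2 * f1 + 2 / 3 * f) / (ξ ^ 2) ^ 2 := by
    rw [eq_div_iff (pow_ne_zero _ (pow_ne_zero _ hξ))]
    linear_combination hcore
  subst h3
  field_simp
  ring

/-! ### STEPS 2(b), 3: the regular-singular form -/

/-- The residue matrix `A = [[3, -3/2, 0], [0, 1, -4/3], [3/2, -9/4, 2]]` of (LC^ε) in `z = (ξν, ξP̂, ξ²Q̂)` has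
`det(A - λ) = -λ(λ - 2)(λ - 4)`: exponents `{0, 2, 4}`. -/
theorem innerLC_residue_charpoly (l : ℝ) :
    Matrix.det !![3 - l, -3/2, 0; 0, 1 - l, -4/3; 3/2, -9/4, (2:ℝ) - l] = -l * (l - 2) * (l - 4) := by
  rw [Matrix.det_fin_three]
  simp
  ring

/-- The leading-coefficient matrix `Ẑ(0)` of the Frobenius basis (columns `z(τ^j)/τ^j` at `τ = 0`, `j = 0, 1, 2`) is invertible. -/
theorem innerLC_Zhat_det :
    Matrix.det !![1, 1, 1; 2, 2/3, -2/3; 3/2, -1/2, (3:ℝ)/2] = -16 / 3 := by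
  rw [Matrix.det_fin_three]
  simp
  norm_num

/-- The columns of `Ẑ(0)`: for `f = τ^j`, `(f, ξP̂, τQ̂)/τ^j = (1, 2 - 4j/3, 2j(j-1) - 2j + 3/2)` at `j = 0, 1, 2`. -/
theorem innerLC_Zhat_columns :
    (2 - 4 * (0:ℝ) / 3 = 2 ∧ 2 * (0:ℝ) * (0 - 1) - 2 * 0 + 3 / 2 = 3 / 2)
    ∧ (2 - 4 * (1:ℝ) / 3 = 2 / 3 ∧ 2 * (1:ℝ) * (1 - 1) - 2 * 1 + 3 / 2 = -1 / 2)
    ∧ (2 - 4 * (2:ℝ) / 3 = -2 / 3 ∧ 2 * (2:ℝ) * (2 - 1) - 2 * 2 + 3 / 2 = 3 / 2) := by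
  norm_num

/-! ### STEP 4(b): fast and slow components of `D` at the hand-over -/

/-- A term `A τ^μ` of `f` contributes `A (2μ² - 4μ + 3/2) τ^{μ-1}` to `Q̂ = 2τ f_ττ - 2 f_τ + (3/2) f/τ`, and
`2μ² - 4μ + 3/2 = 2(μ - 3/2)(μ - 1/2)` vanishes exactly at the two leading exponents of `D`. -/
theorem innerLC_Qhat_exponent (μ : ℝ) :
    2 * (μ * (μ - 1)) - 2 * μ + 3 / 2 = 2 * (μ - 3 / 2) * (μ - 1 / 2) := by
  ring

/-- Hand-over coefficients: a term `A τ^μ` contributes `A(2 - 4μ/3) τ^{μ-1/2}` to `P̂` and `-(9/8)A τ^{μ-3/2}` to the slow graph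
`-(9/8) ν/ξ²`; with `a₀ = 3/2`, `a₁ = -81/64`, `a₂ = -2187/4096` (K31): no `τ` term in `P̂_D`, constant `-27/16` in both,
and the `1/τ` coefficients `(8/3)a₂ = -729/512` vs `-(9/8)a₁ = 729/512`, so `N(D) ξ₀² → 729/256`. -/
theorem innerLC_handover_coeffs :
    (3 / 2 : ℝ) * (2 - 4 * (3 / 2) / 3) = 0
    ∧ (-81 / 64 : ℝ) * (2 - 4 * (1 / 2) / 3) = -27 / 16
    ∧ -(9 / 8 : ℝ) * (3 / 2) = -27 / 16
    ∧ (-2187 / 4096 : ℝ) * (2 - 4 * (-1 / 2) / 3) = -729 / 512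
    ∧ -(9 / 8 : ℝ) * (-81 / 64) = 729 / 512
    ∧ |(-729 / 512 : ℝ) - 729 / 512| = 729 / 256 := by
  norm_num [abs_of_nonneg]

end Summit.NavierStokesRegularity.NavierStokesRegularity.Theorems
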